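import Summits.ValiantsHypothesis.ValiantsHypothesis.Theorems.BarrierLeverAnchoredDoorHitsLowerPairsSplitGeneralRowsConv

/-!
# Support item `AnchoredDoorHitsLowerPairs` (stmt-ValiantsHypothesis-22510), line `anchored-peeling`:
# CONJECTURE SP for all `m` — part 6: COLUMN CODES OF THE SPLIT GRAPH AND THE DECOMPOSITION OF COLUMN SUMS

Helper file (`--supports stmt-ValiantsHypothesis-22510`; cell valiant-natproofs, rung V4, 𝒟-side door (c); registered line
`Cruxes/AnchoredDoorHitsLowerPairs/Lines/anchored_peeling.lean` v24, registered stub `stub_splitFamilyGe3`; prover seat val-np-p1 gen 24;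
memo HOME/val-np-p1/g24/MEMO-SP-proof-valnp1-g24.md §6 B3). Closes NO item.

WHAT. The faces of the complete split graph `K_{2^{m+1}} ∨ I_{2^m−1}` by value (`codeFaces m`: subsets of `range (2^{m+1}+2^m−1)` of size `≤ 2` with
at most one independent vertex) are classified as `∅`, `{enc P}` (`P ⊆ range (m+1)`), `{yu t}` (`t` small), `{enc P, enc P'}` (`enc P < enc P'`),
`{enc P, yu t}`; accordingly a sum over `codeFaces m` splits into five indexed sums (`sum_codeFaces`). Also: the top column function `topCol` of a face
(delta / vertex / convolution of the two vertices) and the swap lemma for sums over ordered versus increasing pairs (`sum_pairs_lt`).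

WHAT THIS IS NOT: nothing on crux stmt-ValiantsHypothesis-14610 or on `VP` versus `VNP`.
-/

set_option linter.dupNamespace false

namespace Summit.ValiantsHypothesis.ValiantsHypothesis.Theorems.BarrierLever.AnchoredPeeling

namespace SplitGeneral

open Finset DecFamily

variable {m : ℕ}

/-! ## 1. Vertex codes -/

/-- Index sets of clique vertices. -/
def cliqueSets (m : ℕ) : Finset (Finset ℕ) := (range (m + 1)).powerset

/-- Membership in `cliqueSets`. -/
theorem mem_cliqueSets {P : Finset ℕ} : P ∈ cliqueSets m ↔ P ⊆ range (m + 1) := Finset.mem_powerset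

/-- Clique codes are exactly `range (2^{m+1})`. -/
theorem image_enc_cliqueSets : (cliqueSets m).image enc = range (2 ^ (m + 1)) := by
  ext y
  rw [Finset.mem_image, Finset.mem_range]
  constructor
  · rintro ⟨P, hP, rfl⟩; exact enc_lt_two_pow (mem_cliqueSets.mp hP)
  · intro hy; exact ⟨bits y, mem_cliqueSets.mpr (bits_subset_range hy), enc_bits y⟩

/-- Independent codes are exactly `[2^{m+1}, 2^{m+1} + 2^m − 1)`. -/
theorem image_yu_smallSets : (smallSets m).image (yu m) = Ico (2 ^ (m + 1)) (2 ^ (m + 1) + 2 ^ m - 1) := by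
  ext y
  rw [Finset.mem_image, Finset.mem_Ico]
  constructor
  · rintro ⟨t, ht, rfl⟩
    obtain ⟨h1, h2, -⟩ := yu_spec ht
    have hM : 1 ≤ 2 ^ m := Nat.one_le_two_pow
    exact ⟨not_lt.mp h1, by omega⟩
  · rintro ⟨h1, h2⟩
    have hne : y + 1 - 2 ^ (m + 1) ≠ 0 := by omega
    have hlt : y + 1 - 2 ^ (m + 1) < 2 ^ m := by omega
    refine ⟨bits (y + 1 - 2 ^ (m + 1)), mem_smallSets.mpr ⟨bits_subset_range hlt, fun h => hne (bits_eq_empty_iff.mp h)⟩, ?_⟩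
    unfold yu; rw [enc_bits]; omega

/-- `enc` is injective (on everything). -/
theorem enc_injOn (s : Set (Finset ℕ)) : Set.InjOn enc s := fun _ _ _ _ h => enc_injective h

/-- `yu` is injective on small sets. -/
theorem yu_injOn : Set.InjOn (yu m) (smallSets m : Set (Finset ℕ)) := by
  intro t ht t' ht' h
  have h0 : enc t ≠ 0 := fun h0 => (mem_smallSets.mp ht).2 (enc_eq_zero_iff.mp h0)
  have h0' : enc t' ≠ 0 := fun h0 => (mem_smallSets.mp ht').2 (enc_eq_zero_iff.mp h0)
  unfold yu at h
  have hM : 1 ≤ 2 ^ m := Nat.one_le_two_pow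
  have h1 : 1 ≤ enc t := Nat.one_le_iff_ne_zero.mpr h0
  have h1' : 1 ≤ enc t' := Nat.one_le_iff_ne_zero.mpr h0'
  exact enc_injective (by omega)

/-- Clique codes are smaller than independent codes. -/
theorem enc_lt_yu {P t : Finset ℕ} (hP : P ∈ cliqueSets m) (ht : t ∈ smallSets m) : enc P < yu m t :=
  lt_of_lt_of_le (enc_lt_two_pow (mem_cliqueSets.mp hP)) (not_lt.mp (yu_spec ht).1)

/-! ## 2. Faces of the split graph and the decomposition of sums -/

/-- The faces of the complete split graph by value: at most two vertices, at most one of them independent. -/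
def codeFaces (m : ℕ) : Finset (Finset ℕ) :=
  (range (2 ^ (m + 1) + 2 ^ m - 1)).powerset.filter
    (fun E => E.card ≤ 2 ∧ ∀ y ∈ E, ∀ y' ∈ E, 2 ^ (m + 1) ≤ y → 2 ^ (m + 1) ≤ y' → y = y')

/-- Membership in `codeFaces`. -/
theorem mem_codeFaces {E : Finset ℕ} : E ∈ codeFaces m ↔
    E ⊆ range (2 ^ (m + 1) + 2 ^ m - 1) ∧ E.card ≤ 2 ∧ ∀ y ∈ E, ∀ y' ∈ E, 2 ^ (m + 1) ≤ y → 2 ^ (m + 1) ≤ y' → y = y' := by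
  rw [codeFaces, Finset.mem_filter, Finset.mem_powerset]

/-- The five shapes of a face. -/
theorem codeFaces_cases {E : Finset ℕ} (hE : E ∈ codeFaces m) :
    E = ∅ ∨ (∃ P ∈ cliqueSets m, E = {enc P}) ∨ (∃ t ∈ smallSets m, E = {yu m t}) ∨
      (∃ P ∈ cliqueSets m, ∃ P' ∈ cliqueSets m, enc P < enc P' ∧ E = {enc P, enc P'}) ∨
      (∃ P ∈ cliqueSets m, ∃ t ∈ smallSets m, E = {enc P, yu m t}) := by
  classical
  obtain ⟨hsub, hcard, hind⟩ := mem_codeFaces.mp hE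
  have hvert : ∀ y ∈ E, (∃ P ∈ cliqueSets m, y = enc P) ∨ (∃ t ∈ smallSets m, y = yu m t) := by
    intro y hy
    have hy' := Finset.mem_range.mp (hsub hy)
    by_cases hlt : y < 2 ^ (m + 1)
    · left
      obtain ⟨P, hP, hPy⟩ := Finset.mem_image.mp (image_enc_cliqueSets (m := m) ▸ Finset.mem_range.mpr hlt)
      exact ⟨P, hP, hPy.symm⟩
    · right
      obtain ⟨t, ht, hty⟩ := Finset.mem_image.mp (image_yu_smallSets (m := m) ▸ Finset.mem_Ico.mpr ⟨not_lt.mp hlt, hy'⟩)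
      exact ⟨t, ht, hty.symm⟩
  by_cases h0 : E.card = 0
  · left; exact Finset.card_eq_zero.mp h0
  by_cases h1 : E.card = 1
  · obtain ⟨y, rfl⟩ := Finset.card_eq_one.mp h1
    rcases hvert y (Finset.mem_singleton_self y) with ⟨P, hP, rfl⟩ | ⟨t, ht, rfl⟩
    · exact Or.inr (Or.inl ⟨P, hP, rfl⟩)
    · exact Or.inr (Or.inr (Or.inl ⟨t, ht, rfl⟩))
  · have h2 : E.card = 2 := by omega
    obtain ⟨y, y', hne, rfl⟩ := Finset.card_eq_two.mp h2
    -- order the two vertices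
    have key : ∀ a b, a ≠ b → a ∈ ({y, y'} : Finset ℕ) → b ∈ ({y, y'} : Finset ℕ) → a < b →
        (∃ P ∈ cliqueSets m, ∃ P' ∈ cliqueSets m, enc P < enc P' ∧ ({a, b} : Finset ℕ) = {enc P, enc P'}) ∨
        (∃ P ∈ cliqueSets m, ∃ t ∈ smallSets m, ({a, b} : Finset ℕ) = {enc P, yu m t}) := by
      intro a b hab ha hb hlt
      rcases hvert a ha with ⟨P, hP, rfl⟩ | ⟨t, ht, rfl⟩ <;> rcases hvert b hb with ⟨P', hP', rfl⟩ | ⟨t', ht', rfl⟩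
      · exact Or.inl ⟨P, hP, P', hP', hlt, rfl⟩
      · exact Or.inr ⟨P, hP, t', ht', rfl⟩
      · exact absurd (hlt.trans (enc_lt_yu hP' ht)) (lt_irrefl _)
      · exact absurd (hind _ ha _ hb (not_lt.mp (yu_spec ht).1) (not_lt.mp (yu_spec ht').1)) (ne_of_lt hlt)
    rcases lt_or_gt_of_ne hne with hlt | hgt
    · rcases key y y' hne (by simp) (by simp) hlt with h | h
      · exact Or.inr (Or.inr (Or.inr (Or.inl h)))
      · exact Or.inr (Or.inr (Or.inr (Or.inr h)))
    · rw [Finset.pair_comm]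
      rcases key y' y hne.symm (by simp) (by simp) hgt with h | h
      · exact Or.inr (Or.inr (Or.inr (Or.inl h)))
      · exact Or.inr (Or.inr (Or.inr (Or.inr h)))

/-- The shapes are faces. -/
theorem empty_mem_codeFaces : (∅ : Finset ℕ) ∈ codeFaces m := mem_codeFaces.mpr ⟨Finset.empty_subset _, by simp, by simp⟩

/-- A clique vertex is a face. -/
theorem clique_mem_codeFaces {P : Finset ℕ} (hP : P ∈ cliqueSets m) : {enc P} ∈ codeFaces m := by
  have h := enc_lt_two_pow (mem_cliqueSets.mp hP)
  have hM : 1 ≤ 2 ^ m := Nat.one_le_two_pow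
  refine mem_codeFaces.mpr ⟨fun y hy => ?_, by simp, fun y hy y' hy' _ _ => ?_⟩
  · rw [Finset.mem_singleton.mp hy, Finset.mem_range]; omega
  · rw [Finset.mem_singleton.mp hy, Finset.mem_singleton.mp hy']

/-- An independent vertex is a face. -/
theorem indep_mem_codeFaces {t : Finset ℕ} (ht : t ∈ smallSets m) : {yu m t} ∈ codeFaces m := by
  obtain ⟨h1, h2, -⟩ := yu_spec ht
  refine mem_codeFaces.mpr ⟨fun y hy => ?_, by simp, fun y hy y' hy' _ _ => ?_⟩
  · rw [Finset.mem_singleton.mp hy, Finset.mem_range]; omega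
  · rw [Finset.mem_singleton.mp hy, Finset.mem_singleton.mp hy']

/-- A clique edge is a face. -/
theorem pair_mem_codeFaces {P P' : Finset ℕ} (hP : P ∈ cliqueSets m) (hP' : P' ∈ cliqueSets m) : {enc P, enc P'} ∈ codeFaces m := by
  have h := enc_lt_two_pow (mem_cliqueSets.mp hP)
  have h' := enc_lt_two_pow (mem_cliqueSets.mp hP')
  have hM : 1 ≤ 2 ^ m := Nat.one_le_two_pow
  refine mem_codeFaces.mpr ⟨fun y hy => ?_, Finset.card_insert_le _ _ |>.trans (by simp), fun y hy y' _ hy2 _ => ?_⟩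
  · rw [Finset.mem_range]
    rcases Finset.mem_insert.mp hy with rfl | hy
    · omega
    · rw [Finset.mem_singleton.mp hy]; omega
  · exfalso
    rcases Finset.mem_insert.mp hy with rfl | hy
    · omega
    · rw [Finset.mem_singleton.mp hy] at hy2; omega

/-- A clique–independent edge is a face. -/
theorem mixed_mem_codeFaces {P t : Finset ℕ} (hP : P ∈ cliqueSets m) (ht : t ∈ smallSets m) : {enc P, yu m t} ∈ codeFaces m := by
  have h := enc_lt_two_pow (mem_cliqueSets.mp hP)
  obtain ⟨h1, h2, -⟩ := yu_spec ht
  refine mem_codeFaces.mpr ⟨fun y hy => ?_, Finset.card_insert_le _ _ |>.trans (by simp), fun y hy y' hy' hy1 hy2 => ?_⟩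
  · rw [Finset.mem_range]
    rcases Finset.mem_insert.mp hy with rfl | hy
    · omega
    · rw [Finset.mem_singleton.mp hy]; omega
  · rcases Finset.mem_insert.mp hy with rfl | hy
    · omega
    · rcases Finset.mem_insert.mp hy' with rfl | hy'
      · omega
      · rw [Finset.mem_singleton.mp hy, Finset.mem_singleton.mp hy']

/-- Increasing ordered pairs of clique index sets. -/
def ltPairs (m : ℕ) : Finset (Finset ℕ × Finset ℕ) := (cliqueSets m ×ˢ cliqueSets m).filter (fun pp => enc pp.1 < enc pp.2)

/-- Membership in `ltPairs`. -/
theorem mem_ltPairs {pp : Finset ℕ × Finset ℕ} : pp ∈ ltPairs m ↔ pp.1 ∈ cliqueSets m ∧ pp.2 ∈ cliqueSets m ∧ enc pp.1 < enc pp.2 := by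
  rw [ltPairs, Finset.mem_filter, Finset.mem_product, and_assoc]

/-- **Decomposition of a sum over the faces of the split graph.** -/
theorem sum_codeFaces (F : Finset ℕ → ℂ) :
    ∑ E ∈ codeFaces m, F E = F ∅ + ∑ P ∈ cliqueSets m, F {enc P} + ∑ t ∈ smallSets m, F {yu m t} +
      ∑ pp ∈ ltPairs m, F {enc pp.1, enc pp.2} + ∑ pt ∈ cliqueSets m ×ˢ smallSets m, F {enc pt.1, yu m pt.2} := by
  classical
  -- the five images
  set A0 : Finset (Finset ℕ) := {∅}
  set A1 := (cliqueSets m).image (fun P => ({enc P} : Finset ℕ))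
  set A2 := (smallSets m).image (fun t => ({yu m t} : Finset ℕ))
  set A3 := (ltPairs m).image (fun pp => ({enc pp.1, enc pp.2} : Finset ℕ))
  set A4 := (cliqueSets m ×ˢ smallSets m).image (fun pt => ({enc pt.1, yu m pt.2} : Finset ℕ))
  -- injectivity of the five maps
  have inj1 : Set.InjOn (fun P => ({enc P} : Finset ℕ)) (cliqueSets m : Set (Finset ℕ)) :=
    fun P _ P' _ h => enc_injective (Finset.singleton_injective h)
  have inj2 : Set.InjOn (fun t => ({yu m t} : Finset ℕ)) (smallSets m : Set (Finset ℕ)) :=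
    fun t ht t' ht' h => yu_injOn ht ht' (Finset.singleton_injective h)
  have inj3 : Set.InjOn (fun pp : Finset ℕ × Finset ℕ => ({enc pp.1, enc pp.2} : Finset ℕ)) (ltPairs m : Set _) := by
    intro pp hpp qq hqq h
    have hpp' := (mem_ltPairs.mp hpp).2.2
    have hqq' := (mem_ltPairs.mp hqq).2.2
    have hmin : enc pp.1 = enc qq.1 := by
      have h1 : ({enc pp.1, enc pp.2} : Finset ℕ).min' (Finset.insert_nonempty _ _) = enc pp.1 :=
        le_antisymm (Finset.min'_le _ _ (by simp)) (Finset.le_min' _ _ _ (fun y hy => by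
          rcases Finset.mem_insert.mp hy with rfl | hy; · exact le_rfl
          · rw [Finset.mem_singleton.mp hy]; exact hpp'.le))
      have h2 : ({enc qq.1, enc qq.2} : Finset ℕ).min' (Finset.insert_nonempty _ _) = enc qq.1 :=
        le_antisymm (Finset.min'_le _ _ (by simp)) (Finset.le_min' _ _ _ (fun y hy => by
          rcases Finset.mem_insert.mp hy with rfl | hy; · exact le_rfl
          · rw [Finset.mem_singleton.mp hy]; exact hqq'.le))
      rw [← h1, ← h2]; congr 1
    have hmax : enc pp.2 = enc qq.2 := by
      have h1 : ({enc pp.1, enc pp.2} : Finset ℕ).max' (Finset.insert_nonempty _ _) = enc pp.2 :=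
        le_antisymm (Finset.max'_le _ _ _ (fun y hy => by
          rcases Finset.mem_insert.mp hy with rfl | hy; · exact hpp'.le
          · rw [Finset.mem_singleton.mp hy])) (Finset.le_max' _ _ (by simp))
      have h2 : ({enc qq.1, enc qq.2} : Finset ℕ).max' (Finset.insert_nonempty _ _) = enc qq.2 :=
        le_antisymm (Finset.max'_le _ _ _ (fun y hy => by
          rcases Finset.mem_insert.mp hy with rfl | hy; · exact hqq'.le
          · rw [Finset.mem_singleton.mp hy])) (Finset.le_max' _ _ (by simp))
      rw [← h1, ← h2]; congr 1
    exact Prod.ext (enc_injective hmin) (enc_injective hmax)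
  have inj4 : Set.InjOn (fun pt : Finset ℕ × Finset ℕ => ({enc pt.1, yu m pt.2} : Finset ℕ))
      ((cliqueSets m ×ˢ smallSets m : Finset (Finset ℕ × Finset ℕ)) : Set (Finset ℕ × Finset ℕ)) := by
    intro pt hpt qt hqt h
    obtain ⟨hp1, hp2⟩ := Finset.mem_product.mp hpt
    obtain ⟨hq1, hq2⟩ := Finset.mem_product.mp hqt
    have hpl := enc_lt_yu hp1 hp2
    have hql := enc_lt_yu hq1 hq2
    have hmin : enc pt.1 = enc qt.1 := by
      have h1 : ({enc pt.1, yu m pt.2} : Finset ℕ).min' (Finset.insert_nonempty _ _) = enc pt.1 :=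
        le_antisymm (Finset.min'_le _ _ (by simp)) (Finset.le_min' _ _ _ (fun y hy => by
          rcases Finset.mem_insert.mp hy with rfl | hy; · exact le_rfl
          · rw [Finset.mem_singleton.mp hy]; exact hpl.le))
      have h2 : ({enc qt.1, yu m qt.2} : Finset ℕ).min' (Finset.insert_nonempty _ _) = enc qt.1 :=
        le_antisymm (Finset.min'_le _ _ (by simp)) (Finset.le_min' _ _ _ (fun y hy => by
          rcases Finset.mem_insert.mp hy with rfl | hy; · exact le_rfl
          · rw [Finset.mem_singleton.mp hy]; exact hql.le))
      rw [← h1, ← h2]; congr 1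
    have hmax : yu m pt.2 = yu m qt.2 := by
      have h1 : ({enc pt.1, yu m pt.2} : Finset ℕ).max' (Finset.insert_nonempty _ _) = yu m pt.2 :=
        le_antisymm (Finset.max'_le _ _ _ (fun y hy => by
          rcases Finset.mem_insert.mp hy with rfl | hy; · exact hpl.le
          · rw [Finset.mem_singleton.mp hy])) (Finset.le_max' _ _ (by simp))
      have h2 : ({enc qt.1, yu m qt.2} : Finset ℕ).max' (Finset.insert_nonempty _ _) = yu m qt.2 :=
        le_antisymm (Finset.max'_le _ _ _ (fun y hy => by
          rcases Finset.mem_insert.mp hy with rfl | hy; · exact hql.le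
          · rw [Finset.mem_singleton.mp hy])) (Finset.le_max' _ _ (by simp))
      rw [← h1, ← h2]; congr 1
    exact Prod.ext (enc_injective hmin) (yu_injOn hp2 hq2 hmax)
  -- codeFaces = union
  have hunion : codeFaces m = A0 ∪ A1 ∪ A2 ∪ A3 ∪ A4 := by
    ext E
    simp only [Finset.mem_union, A0, A1, A2, A3, A4, Finset.mem_singleton, Finset.mem_image]
    constructor
    · intro hE
      rcases codeFaces_cases hE with h | ⟨P, hP, h⟩ | ⟨t, ht, h⟩ | ⟨P, hP, P', hP', hlt, h⟩ | ⟨P, hP, t, ht, h⟩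
      · exact Or.inl (Or.inl (Or.inl (Or.inl h)))
      · exact Or.inl (Or.inl (Or.inl (Or.inr ⟨P, hP, h.symm⟩)))
      · exact Or.inl (Or.inl (Or.inr ⟨t, ht, h.symm⟩))
      · exact Or.inl (Or.inr ⟨(P, P'), mem_ltPairs.mpr ⟨hP, hP', hlt⟩, h.symm⟩)
      · exact Or.inr ⟨(P, t), Finset.mem_product.mpr ⟨hP, ht⟩, h.symm⟩
    · rintro ((((rfl | ⟨P, hP, rfl⟩) | ⟨t, ht, rfl⟩) | ⟨pp, hpp, rfl⟩) | ⟨pt, hpt, rfl⟩)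
      · exact empty_mem_codeFaces
      · exact clique_mem_codeFaces hP
      · exact indep_mem_codeFaces ht
      · obtain ⟨h1, h2, -⟩ := mem_ltPairs.mp hpp; exact pair_mem_codeFaces h1 h2
      · obtain ⟨h1, h2⟩ := Finset.mem_product.mp hpt; exact mixed_mem_codeFaces h1 h2
  -- pairwise disjointness via cardinalities / code ranges
  have card2 : ∀ {a b : ℕ}, a < b → ({a, b} : Finset ℕ).card = 2 := fun hab => Finset.card_pair (ne_of_lt hab)
  have d01 : Disjoint A0 A1 := by
    rw [Finset.disjoint_left]; intro E hE hE'
    rw [Finset.mem_singleton] at hE; subst hE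
    obtain ⟨P, -, h⟩ := Finset.mem_image.mp hE'; exact Finset.singleton_ne_empty _ h
  have d02 : Disjoint (A0 ∪ A1) A2 := by
    rw [Finset.disjoint_left]; intro E hE hE'
    obtain ⟨t, ht, rfl⟩ := Finset.mem_image.mp hE'
    rcases Finset.mem_union.mp hE with h | h
    · exact Finset.singleton_ne_empty _ (Finset.mem_singleton.mp h)
    · obtain ⟨P, hP, h⟩ := Finset.mem_image.mp h
      have := enc_lt_yu hP ht
      rw [Finset.singleton_injective h] at this; exact lt_irrefl _ this
  have d03 : Disjoint (A0 ∪ A1 ∪ A2) A3 := by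
    rw [Finset.disjoint_left]; intro E hE hE'
    obtain ⟨pp, hpp, rfl⟩ := Finset.mem_image.mp hE'
    have hc := card2 (mem_ltPairs.mp hpp).2.2
    rcases Finset.mem_union.mp hE with h | h
    · rcases Finset.mem_union.mp h with h | h
      · rw [Finset.mem_singleton] at h; rw [h] at hc; simp at hc
      · obtain ⟨P, -, h⟩ := Finset.mem_image.mp h; rw [← h] at hc; simp at hc
    · obtain ⟨t, -, h⟩ := Finset.mem_image.mp h; rw [← h] at hc; simp at hc
  have d04 : Disjoint (A0 ∪ A1 ∪ A2 ∪ A3) A4 := by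
    rw [Finset.disjoint_left]; intro E hE hE'
    obtain ⟨pt, hpt, rfl⟩ := Finset.mem_image.mp hE'
    obtain ⟨hp1, hp2⟩ := Finset.mem_product.mp hpt
    have hc := card2 (enc_lt_yu hp1 hp2)
    rcases Finset.mem_union.mp hE with h | h
    · rcases Finset.mem_union.mp h with h | h
      · rcases Finset.mem_union.mp h with h | h
        · rw [Finset.mem_singleton] at h; rw [h] at hc; simp at hc
        · obtain ⟨P, -, h⟩ := Finset.mem_image.mp h; rw [← h] at hc; simp at hc
      · obtain ⟨t, -, h⟩ := Finset.mem_image.mp h; rw [← h] at hc; simp at hc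
    · obtain ⟨pp, hpp, h⟩ := Finset.mem_image.mp h
      -- the independent code `yu pt.2` is the max of the right set but exceeds every clique code
      have hmem : yu m pt.2 ∈ ({enc pp.1, enc pp.2} : Finset ℕ) := by rw [h]; simp
      obtain ⟨hq1, hq2, -⟩ := mem_ltPairs.mp hpp
      rcases Finset.mem_insert.mp hmem with h' | h'
      · exact absurd h' (ne_of_gt (enc_lt_yu hq1 hp2))
      · exact absurd (Finset.mem_singleton.mp h') (ne_of_gt (enc_lt_yu hq2 hp2))
  rw [hunion, Finset.sum_union d04, Finset.sum_union d03, Finset.sum_union d02, Finset.sum_union d01]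
  simp only [A0, A1, A2, A3, A4, Finset.sum_singleton]
  rw [Finset.sum_image inj1, Finset.sum_image inj2, Finset.sum_image inj3, Finset.sum_image inj4]

/-- **Swap lemma**: a sum over increasing pairs of a symmetrised summand is the sum over all ordered distinct pairs. -/
theorem sum_pairs_lt (G : Finset ℕ → Finset ℕ → ℂ) :
    ∑ pp ∈ ltPairs m, (G pp.1 pp.2 + G pp.2 pp.1) = ∑ pp ∈ (cliqueSets m ×ˢ cliqueSets m).filter (fun pp => pp.1 ≠ pp.2), G pp.1 pp.2 := by
  classical
  rw [Finset.sum_add_distrib]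
  have hsplit : (cliqueSets m ×ˢ cliqueSets m).filter (fun pp => pp.1 ≠ pp.2) =
      ltPairs m ∪ (cliqueSets m ×ˢ cliqueSets m).filter (fun pp => enc pp.2 < enc pp.1) := by
    ext pp
    simp only [Finset.mem_filter, Finset.mem_union, mem_ltPairs, Finset.mem_product]
    constructor
    · rintro ⟨⟨h1, h2⟩, hne⟩
      rcases lt_or_gt_of_ne (fun h => hne (enc_injective h)) with h | h
      · exact Or.inl ⟨h1, h2, h⟩
      · exact Or.inr ⟨⟨h1, h2⟩, h⟩
    · rintro (⟨h1, h2, h⟩ | ⟨⟨h1, h2⟩, h⟩)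
      · exact ⟨⟨h1, h2⟩, fun heq => lt_irrefl _ (heq ▸ h)⟩
      · exact ⟨⟨h1, h2⟩, fun heq => lt_irrefl _ (heq ▸ h)⟩
  have hdis : Disjoint (ltPairs m) ((cliqueSets m ×ˢ cliqueSets m).filter (fun pp => enc pp.2 < enc pp.1)) := by
    rw [Finset.disjoint_left]
    intro pp h1 h2
    exact lt_asymm (mem_ltPairs.mp h1).2.2 (Finset.mem_filter.mp h2).2
  rw [hsplit, Finset.sum_union hdis]
  congr 1
  refine Finset.sum_nbij' (fun pp => (pp.2, pp.1)) (fun pp => (pp.2, pp.1)) ?_ ?_ ?_ ?_ ?_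
  · intro pp hpp
    obtain ⟨h1, h2, h⟩ := mem_ltPairs.mp hpp
    exact Finset.mem_filter.mpr ⟨Finset.mem_product.mpr ⟨h2, h1⟩, h⟩
  · intro pp hpp
    obtain ⟨h12, h⟩ := Finset.mem_filter.mp hpp
    obtain ⟨h1, h2⟩ := Finset.mem_product.mp h12
    exact mem_ltPairs.mpr ⟨h2, h1, h⟩
  · intro pp _; rfl
  · intro pp _; rfl
  · intro pp _; rfl

/-! ## 3. The top column function of a face -/

/-- The leading (limit) column of the face `E`: delta of `∅`, a vertex, or the convolution of the two vertices. -/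
noncomputable def topCol (m : ℕ) (E : Finset ℕ) (C : Finset ℕ) : ℂ :=
  if h : E.Nonempty then (if E.card = 1 then vtopN m (E.min' h) C else conv (vtopN m (E.min' h)) (vtopN m (E.max' h)) C)
  else ind (C = ∅)

/-- `topCol ∅`. -/
theorem topCol_empty (C : Finset ℕ) : topCol m ∅ C = ind (C = ∅) := by
  unfold topCol; rw [dif_neg Finset.not_nonempty_empty]

/-- `topCol {y}`. -/
theorem topCol_singleton (y : ℕ) (C : Finset ℕ) : topCol m {y} C = vtopN m y C := by
  unfold topCol; rw [dif_pos (Finset.singleton_nonempty y), if_pos (Finset.card_singleton y), Finset.min'_singleton]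

/-- `topCol {y, y'}` for `y < y'`. -/
theorem topCol_pair {y y' : ℕ} (h : y < y') (C : Finset ℕ) : topCol m {y, y'} C = conv (vtopN m y) (vtopN m y') C := by
  have hne : y ≠ y' := ne_of_lt h
  unfold topCol
  rw [dif_pos (Finset.insert_nonempty _ _), if_neg (by rw [Finset.card_pair hne]; norm_num)]
  have hmin : ({y, y'} : Finset ℕ).min' (Finset.insert_nonempty _ _) = y :=
    le_antisymm (Finset.min'_le _ _ (by simp)) (Finset.le_min' _ _ _ (fun z hz => by
      rcases Finset.mem_insert.mp hz with rfl | hz; · exact le_rfl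
      · rw [Finset.mem_singleton.mp hz]; exact h.le))
  have hmax : ({y, y'} : Finset ℕ).max' (Finset.insert_nonempty _ _) = y' :=
    le_antisymm (Finset.max'_le _ _ _ (fun z hz => by
      rcases Finset.mem_insert.mp hz with rfl | hz; · exact h.le
      · rw [Finset.mem_singleton.mp hz])) (Finset.le_max' _ _ (by simp))
  rw [hmin, hmax]

end SplitGeneral

end Summit.ValiantsHypothesis.ValiantsHypothesis.Theorems.BarrierLever.AnchoredPeeling
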